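import Mathlib.Data.Fin.Tuple.Sort
import Summits.CriticalPhenomena.PercolationContinuityZ3.Theorems.SahiCopyKernel
import Summits.CriticalPhenomena.PercolationContinuityZ3.Theorems.SahiLiebSahiContinuum

/-!
# THE PATTERN FUNCTIONAL OF EVERY ORDER: Sahi's `C_n` (every `n`) is ONE finite inequality per dimension on the
# small cube `[n]^d`; the cell `(d,n)` of the width phase diagram follows from `PatternPosN n d`

Support file (Sahi cell `prim-sahi`, seat `prim-sahi-typer`, generation 26; `--supports stmt-CriticalPhenomena-4575`).  Pure
proofs; the only definitions are the bookkeeping ones of the localisation (`Tmap`, `Ssym`, `col`, `sStarN`, `pb`, `liftSet`) and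
the finite predicate `PatternPosN n d`; no `sorry`; kernel-checked, standard axioms.  This is the order-`n` version of
`SahiGridPattern` (seat `prim-sahi-p1`, generation 7: order `3`, `sStarD`, `PatternPos d`), built on the `n`-copy identity
`SahiCopyKernel.sahiE_setInd_eq_sum_copyKernel` instead of the three-copy identity.

THE MATHEMATICS.  Fix an order `n`.  For `d ≥ 0` let `P = [n]^d = Fin d → Fin n` (pointwise order).  A PERMUTATION PATTERN is
`π ∈ S_n^d`; its `c`-th point is `col π c = (a ↦ π_a c)` — `n` points of `[n]^d` using every value exactly once on every axis
(a Latin hypercube sample of size `n`).  For `A_0,…,A_{n−1} ⊆ [n]^d` put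
  `sStarN n d A := Σ_{π ∈ S_n^d} K_n([col π c ∈ A_i])`,
`K_n` the integer `n`-copy kernel of `SahiCopyKernel` (for `n = 3` this is `SahiGridPattern.sStarD` — companion file
`SahiGridPatternOrderNThree`), and
  `PatternPosN n d :⟺ sStarN n d A ≥ 0 for all n-tuples of UP-SETS A_i of [n]^d`.
* `sahiE_symm`, `S_eq_sStarN`, `Ssym_nonneg_of`: for every product probability weight `⊗_a g_a` on a grid `[K+1]^d` and all
  up-sets, `(n!)^d · E_n(1_{A_0},…,1_{A_{n−1}}) = Σ_ω (∏ w(ω_c)) · sStarN n d (A*_ω)` with pulled-back (and, after sorting the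
  copies axis by axis, UP-) sets of the small cube — so `PatternPosN n d` says that the homogeneous form `Z^n E_n` of a product
  weight on a `d`-dimensional grid has NONNEGATIVE COEFFICIENTS in the `d` chain-weight vectors, and implies `E_n ≥ 0`.
* `liebSahi_grid_of_patternPosN`: `PatternPosN n d ⟹` layer `P(d,n)` (every product probability weight on every `d`-grid is
  Sahi-positive of order `n`), hence `U(d,n)`, `W(d,n)` (uniform boxes; all FKG weights on `d`-grids and on lattices of J-width
  `≤ d`) and Lieb–Sahi's continuum statement `LiebSahiContinuum d n` — i.e. THE CELL `(d,n)`.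
* **`sahiConjecture_of_forall_patternPosN`**: `(∀ d, PatternPosN n d) ⟹ SahiConjecture n` (Sahi 2008 Conj. 5 at order `n`
  for every FKG weight on every finite distributive lattice).  So for EVERY `n`, Sahi's `C_n` is reduced to a sequence of FINITE
  order-`n` inequalities for Latin hypercube samples, one per dimension; the first open cell `(3,4)` is the single finite
  inequality `PatternPosN 4 3` on `[4]^3` (232 848 up-sets).
* `patternPosN_anti`: `PatternPosN n (d+1) → PatternPosN n d` (lift along the last axis, factor `n!`).
STATUS (seat census, two independent implementations of the kernel agree with `sStarD` at `n = 3` on all `8000` triples of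
`[3]^2`): `PatternPosN 4 2` HOLDS (all `1 088 430` sorted quadruples of the `70` up-sets of `[4]^2`, minimum `0`, `60 085` zeros) —
coefficientwise positivity of `Z⁴E₄` on two-dimensional grids, not implied by Lieb–Sahi's theorem `E_n ≥ 0` on `[0,1]²`;
`PatternPosN 4 3` (= cell `(3,4)` coefficientwise) and `PatternPosN 5 2`: kit census in progress at the time of writing.
Nothing in this file asserts `PatternPosN n d` for any `n ≥ 3`, `d ≥ 1`, nor `SahiConjecture n`. [this work]
-/

namespace Summit.CriticalPhenomena.PercolationContinuityZ3.Theorems.SahiGridPatternN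

open Finset Literature.Probability.LatticeModels Literature.Combinatorics.Sahi2008
open SahiCopyKernel (copyKernel incMatrix sahiE_setInd_eq_sum_copyKernel)
open scoped BigOperators

noncomputable section

variable {n d K : ℕ}

/-- The grid `[K+1]^d`. [this work] -/
abbrev Xd (d K : ℕ) := Fin d → Fin (K + 1)

/-- The small cube `[n]^d` of order `n`. [this work] -/
abbrev Pn (n d : ℕ) := Fin d → Fin n

/-! ### Re-indexing the `n` copies axis by axis -/

/-- `(T_π ω)_c(a) = ω_{π_a c}(a)`: permute the `n` copies separately in each axis. [this work] -/
def Tmap (π : Fin d → Equiv.Perm (Fin n)) (ω : Fin n → Xd d K) : Fin n → Xd d K := fun c a => ω (π a c) a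

/-- `T_π` as an equivalence. [this work] -/
def Tequiv (π : Fin d → Equiv.Perm (Fin n)) : (Fin n → Xd d K) ≃ (Fin n → Xd d K) where
  toFun := Tmap π
  invFun := fun ω c a => ω ((π a).symm c) a
  left_inv := fun ω => by funext c a; simp [Tmap]
  right_inv := fun ω => by funext c a; simp [Tmap]

/-- The product weight of the `n` copies is invariant under re-indexing. [this work] -/
theorem weight_Tmap (g : Fin d → Fin (K + 1) → ℝ) (π : Fin d → Equiv.Perm (Fin n)) (ω : Fin n → Xd d K) :
    (∏ c, ∏ a, g a (Tmap π ω c a)) = ∏ c, ∏ a, g a (ω c a) := by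
  calc (∏ c, ∏ a, g a (Tmap π ω c a)) = ∏ a, ∏ c, g a (ω (π a c) a) := Finset.prod_comm
    _ = ∏ a, ∏ c, g a (ω c a) := Finset.prod_congr rfl fun a _ => Equiv.prod_comp (π a) (fun c => g a (ω c a))
    _ = ∏ c, ∏ a, g a (ω c a) := Finset.prod_comm

/-- The symmetrised `n`-copy kernel `S(ω) = Σ_{π ∈ S_n^d} K_n([ (T_π ω)_c ∈ A_i ])`. [this work] -/
def Ssym (A : Fin n → Finset (Xd d K)) (ω : Fin n → Xd d K) : ℤ :=
  ∑ π : Fin d → Equiv.Perm (Fin n), copyKernel n (incMatrix A (Tmap π ω))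

/-- **Symmetrisation**: `|S_n^d| · E_n(1_{A_0},…,1_{A_{n−1}}) = Σ_ω (∏ w) · S(ω)` for a product probability weight. [this work] -/
theorem sahiE_symm (g : Fin d → Fin (K + 1) → ℝ) (hg1 : ∀ a, ∑ u, g a u = 1) (A : Fin n → Finset (Xd d K)) :
    (Fintype.card (Fin d → Equiv.Perm (Fin n)) : ℝ) * sahiE (fun ω : Xd d K => ∏ a, g a (ω a)) n (fun i => setInd (A i)) =
      ∑ ω : Fin n → Xd d K, (∏ c, ∏ a, g a (ω c a)) * (Ssym A ω : ℝ) := by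
  have hsum : ∑ ω : Xd d K, ∏ a, g a (ω a) = 1 := by
    rw [← Fintype.prod_sum]; simp [hg1]
  have hπ : ∀ π : Fin d → Equiv.Perm (Fin n), sahiE (fun ω : Xd d K => ∏ a, g a (ω a)) n (fun i => setInd (A i)) =
      ∑ ω : Fin n → Xd d K, (∏ c, ∏ a, g a (ω c a)) * ((copyKernel n (incMatrix A (Tmap π ω)) : ℤ) : ℝ) := by
    intro π
    rw [sahiE_setInd_eq_sum_copyKernel _ hsum, ← Equiv.sum_comp (Tequiv π)]
    refine Finset.sum_congr rfl fun ω _ => ?_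
    show (∏ c, ∏ a, g a (Tmap π ω c a)) * _ = _
    rw [weight_Tmap]
    rfl
  rw [← nsmul_eq_mul, ← Finset.card_univ, ← Finset.sum_const, Finset.sum_congr rfl fun π _ => hπ π, Finset.sum_comm]
  refine Finset.sum_congr rfl fun ω _ => ?_
  rw [← Finset.mul_sum]
  unfold Ssym
  push_cast
  rfl

/-! ### The pattern functional `sStarN` on the small cube and the pull-back -/

/-- The `c`-th point of the permutation pattern `π ∈ S_n^d`: `a ↦ π_a c`. [this work] -/
def col (π : Fin d → Equiv.Perm (Fin n)) (c : Fin n) : Pn n d := fun a => π a c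

/-- **`sStarN n d`**: the integer `n`-copy kernel summed over the `(n!)^d` permutation patterns of `[n]^d`. [this work] -/
def sStarN (n d : ℕ) (A : Fin n → Finset (Pn n d)) : ℤ :=
  ∑ π : Fin d → Equiv.Perm (Fin n), copyKernel n (incMatrix A (col π))

/-- **`PatternPosN n d`** — THE ORDER-`n` PATTERN INEQUALITY ON `[n]^d`: `sStarN n d A ≥ 0` for all `n`-tuples of up-sets
(equivalently: Sahi's `E_n` of up-set indicators is nonnegative under `n`-point LATIN HYPERCUBE SAMPLING of `[n]^d`; equivalently:
the homogeneous form `Z^n E_n` on `d`-dimensional grids with product weights has nonnegative coefficients in the chain weights).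
`n = 3` is `SahiGridPattern.PatternPos d` (proved `d ≤ 3`, certified `d = 4`).  Seat census: `PatternPosN 4 2` holds (exhaustive,
two engines); `PatternPosN 4 3`, `PatternPosN 5 2` under census.  `∀ d, PatternPosN n d` implies `SahiConjecture n`
(`sahiConjecture_of_forall_patternPosN`).  An obligation / hypothesis, never a fact. [this work]
[status: open for n ≥ 3 beyond (n,d) ∈ {(3,≤3) proved, (3,4) certified, (4,≤2) census}] -/
@[conjecture] def PatternPosN (n d : ℕ) : Prop :=
  ∀ A : Fin n → Finset (Pn n d), (∀ i, IsUpperSet (A i : Set (Pn n d))) → 0 ≤ sStarN n d A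

/-- Pull-back of a finset of the grid to the small cube along `ω`: `q ↦ (a ↦ ω_{q a}(a))`. [this work] -/
def pb (ω : Fin n → Xd d K) (A : Finset (Xd d K)) : Finset (Pn n d) := univ.filter fun q => (fun a => ω (q a) a) ∈ A

/-- Incidence matrices under pull-back. [this work] -/
theorem incMatrix_Tmap (A : Fin n → Finset (Xd d K)) (ω : Fin n → Xd d K) (π : Fin d → Equiv.Perm (Fin n)) :
    incMatrix A (Tmap π ω) = incMatrix (fun i => pb ω (A i)) (col π) := by
  funext i c
  unfold incMatrix pb Tmap col
  simp only [mem_filter, mem_univ, true_and]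

/-- **`S(ω) = sStarN n d (pb ω ∘ A)`.** [this work] -/
theorem S_eq_sStarN (A : Fin n → Finset (Xd d K)) (ω : Fin n → Xd d K) :
    Ssym A ω = sStarN n d (fun i => pb ω (A i)) := by
  unfold Ssym sStarN
  exact Finset.sum_congr rfl fun π _ => by rw [incMatrix_Tmap]

/-- Composing with fixed permutations axis by axis does not change `S`. [this work] -/
theorem S_Tmap (A : Fin n → Finset (Xd d K)) (σ : Fin d → Equiv.Perm (Fin n)) (ω : Fin n → Xd d K) :
    Ssym A (Tmap σ ω) = Ssym A ω := by
  unfold Ssym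
  have h : ∀ π : Fin d → Equiv.Perm (Fin n), Tmap π (Tmap σ ω) = Tmap (fun a => (π a).trans (σ a)) ω := by
    intro π; funext c a; rfl
  simp_rw [h]
  exact Fintype.sum_equiv (Equiv.piCongrRight fun a => Equiv.mulLeft (σ a)) _ _ fun π => rfl

/-- A sorted `ω` pulls up-sets back to up-sets. [this work] -/
theorem isUpperSet_pb {ω : Fin n → Xd d K} (hω : ∀ a, Monotone fun c => ω c a) {A : Finset (Xd d K)}
    (hA : IsUpperSet (A : Set (Xd d K))) : IsUpperSet (pb ω A : Set (Pn n d)) := by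
  intro q q' hqq' hq
  rw [Finset.mem_coe] at hq ⊢
  unfold pb at hq ⊢
  rw [mem_filter] at hq ⊢
  exact ⟨mem_univ _, hA (fun a => hω a (hqq' a)) hq.2⟩

/-- **`S(ω) ≥ 0`** for up-sets, GIVEN the pattern inequality of order `n` in dimension `d`: sort, pull back, apply it.
[this work] -/
theorem Ssym_nonneg_of (hP : PatternPosN n d) {A : Fin n → Finset (Xd d K)} (hA : ∀ i, IsUpperSet (A i : Set (Xd d K)))
    (ω : Fin n → Xd d K) : 0 ≤ Ssym A ω := by
  let σ : Fin d → Equiv.Perm (Fin n) := fun a => Tuple.sort fun c => ω c a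
  have hsort : ∀ a, Monotone fun c => Tmap σ ω c a := fun a => by
    show Monotone ((fun c => ω c a) ∘ σ a)
    exact Tuple.monotone_sort _
  rw [← S_Tmap A σ ω, S_eq_sStarN]
  exact hP _ fun i => isUpperSet_pb hsort (hA i)

/-! ### `PatternPosN n d ⟹ P(d,n)` — the cell `(d,n)` -/

/-- **`PatternPosN n d ⟹` Sahi's `C_n` for up-set indicators on every `d`-dimensional grid** with a product probability weight.
[this work] -/
theorem sahiE_gridProd_setInd_nonneg_of (hP : PatternPosN n d) (g : Fin d → Fin (K + 1) → ℝ) (hg0 : ∀ a u, 0 ≤ g a u)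
    (hg1 : ∀ a, ∑ u, g a u = 1) {A : Fin n → Finset (Xd d K)} (hA : ∀ i, IsUpperSet (A i : Set (Xd d K))) :
    0 ≤ sahiE (fun ω : Xd d K => ∏ a, g a (ω a)) n (fun i => setInd (A i)) := by
  have hcard : (0 : ℝ) < Fintype.card (Fin d → Equiv.Perm (Fin n)) := by exact_mod_cast Fintype.card_pos
  have h := sahiE_symm g hg1 A
  have hsum : 0 ≤ ∑ ω : Fin n → Xd d K, (∏ c, ∏ a, g a (ω c a)) * (Ssym A ω : ℝ) :=
    Finset.sum_nonneg fun ω _ => mul_nonneg (Finset.prod_nonneg fun c _ => Finset.prod_nonneg fun a _ => hg0 a _)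
      (by exact_mod_cast Ssym_nonneg_of hP hA ω)
  rw [← h] at hsum
  exact (mul_nonneg_iff_of_pos_left hcard).1 hsum

/-- **`PatternPosN n d ⟹` layer `P(d,n)`**: every product probability weight on every grid `[K+1]^d` is Sahi-positive of order
`n`. [this work] -/
theorem liebSahi_grid_of_patternPosN (hP : PatternPosN n d) :
    ∀ (K : ℕ) (g : Fin d → Fin (K + 1) → ℝ), (∀ i u, 0 ≤ g i u) → (∀ i, ∑ u, g i u = 1) →
      SahiPositive (fun ω : Fin d → Fin (K + 1) => ∏ i, g i (ω i)) n := by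
  classical
  intro K g hg0 hg1
  rw [sahiPositive_iff_indicators]
  intro U hU
  exact sahiE_gridProd_setInd_nonneg_of hP g hg0 hg1 hU

/-- `PatternPosN n d ⟹ U(d,n)`: the uniform weight on every box `[M]^d` is Sahi-positive of order `n`. [this work] -/
theorem uniformGrid_of_patternPosN (hP : PatternPosN n d) :
    ∀ M, 0 < M → SahiPositive (fun _ : Fin d → Fin M => (1 : ℝ) / (M : ℝ) ^ d) n :=
  (SahiWidth.liebSahi_grid_iff_uniform d n).1 (liebSahi_grid_of_patternPosN hP)

/-- `PatternPosN n d ⟹ W(d,n)`: EVERY FKG probability weight on every grid `[b+1]^d` is Sahi-positive of order `n`. [this work] -/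
theorem fkg_grid_of_patternPosN (hP : PatternPosN n d) :
    ∀ (b : ℕ) (μ : (Fin d → Fin (b + 1)) → ℝ), IsFKGMeasure μ → SahiPositive μ n :=
  (SahiWidth.liebSahi_grid_iff_fkg_grid d n).1 (liebSahi_grid_of_patternPosN hP)

/-- `PatternPosN n d ⟹` Sahi's `C_n` for every FKG weight on every finite distributive lattice with a lattice embedding into a
`d`-dimensional grid (J-width `≤ d`; e.g. every product of `d` finite chains). [this work] -/
theorem sahiPositive_of_latticeEmbedding_of_patternPosN (hP : PatternPosN n d) {L : Type*} [DistribLattice L] [Fintype L]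
    [DecidableEq L] {b : ℕ} (e : L → (Fin d → Fin (b + 1))) (he : Function.Injective e) (hinf : ∀ x y, e (x ⊓ y) = e x ⊓ e y)
    (hsup : ∀ x y, e (x ⊔ y) = e x ⊔ e y) {μ : L → ℝ} (hμ : IsFKGMeasure μ) : SahiPositive μ n :=
  SahiWidth.sahiPositive_of_latticeEmbedding_grid (liebSahi_grid_of_patternPosN hP) e he hinf hsup hμ

/-- **`PatternPosN n d ⟹` Lieb–Sahi's Conjecture 1.1 on `[0,1]^d` at order `n`** (Lebesgue measure, monotone functions): the
cell `(d,n)` of the width phase diagram. [this work] -/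
theorem liebSahiContinuum_of_patternPosN (hP : PatternPosN n d) : LiebSahiContinuum d n :=
  (liebSahiContinuum_iff_uniformGrid d n).2 (uniformGrid_of_patternPosN hP)


/-- **The first open cell `(3,4)` as ONE finite inequality**: `PatternPosN 4 3` (`sStarN 4 3 ≥ 0` on up-set quadruples of `[4]^3`,
which has `232 848` up-sets) implies Lieb–Sahi's Conjecture 1.1 on `[0,1]³` at order `4` and Sahi's `C₄` for every FKG probability
weight on every three-dimensional grid (hence for three-block exchangeable families at order `4`).  Nothing here asserts the
hypothesis. [this work] -/
theorem cell_three_four_of_patternPosN (h : PatternPosN 4 3) :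
    LiebSahiContinuum 3 4 ∧ ∀ (b : ℕ) (μ : (Fin 3 → Fin (b + 1)) → ℝ), IsFKGMeasure μ → SahiPositive μ 4 :=
  ⟨liebSahiContinuum_of_patternPosN h, fkg_grid_of_patternPosN h⟩

/-- Likewise the cell `(2,5)`, `(3,5)`, …: `PatternPosN n d` names the finite inequality behind every cell; for the record, the
general bundled form. [this work] -/
theorem cell_of_patternPosN (h : PatternPosN n d) :
    LiebSahiContinuum d n ∧ ∀ (b : ℕ) (μ : (Fin d → Fin (b + 1)) → ℝ), IsFKGMeasure μ → SahiPositive μ n :=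
  ⟨liebSahiContinuum_of_patternPosN h, fkg_grid_of_patternPosN h⟩

/-! ### The reduction of Sahi's `C_n` to the pattern inequalities of order `n` -/

/-- **The order-`n` pattern inequalities in all dimensions imply Sahi's `C_n`**: if `sStarN n d ≥ 0` on up-set tuples of `[n]^d`
for every `d`, then every FKG probability weight on every finite distributive lattice satisfies `E_n(f_0,…,f_{n−1}) ≥ 0` for
nonnegative monotone families (Sahi 2008, Conj. 5 at order `n`; Lieb–Sahi 2022, Conj. 1.1 at order `n`). [this work] -/
theorem sahiConjecture_of_forall_patternPosN (hP : ∀ d, PatternPosN n d) : SahiConjecture n :=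
  (SahiWidth.sahiConjecture_iff_forall_grid n).2 fun d K g hg0 hg1 => liebSahi_grid_of_patternPosN (hP d) K g hg0 hg1

/-- **The whole hierarchy**: the pattern inequalities of every order in every dimension imply `C_n` for every `n`. [this work] -/
theorem forall_sahiConjecture_of_forall_patternPosN (hP : ∀ n d, PatternPosN n d) : ∀ n, SahiConjecture n :=
  fun n => sahiConjecture_of_forall_patternPosN (hP n)

/-! ### Monotonicity in the dimension -/

/-- Lifting a subset of `[n]^d` to `[n]^{d+1}` by ignoring the last coordinate. [this work] -/
def liftSet (A : Finset (Pn n d)) : Finset (Pn n (d + 1)) := univ.filter fun q => Fin.init q ∈ A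

/-- The lift of an up-set is an up-set. [this work] -/
theorem isUpperSet_liftSet {A : Finset (Pn n d)} (hA : IsUpperSet (A : Set (Pn n d))) :
    IsUpperSet (liftSet A : Set (Pn n (d + 1))) := by
  intro q q' hqq' hq
  rw [Finset.mem_coe] at hq ⊢
  unfold liftSet at hq ⊢
  rw [mem_filter] at hq ⊢
  exact ⟨mem_univ _, hA (fun a => hqq' (Fin.castSucc a)) hq.2⟩

/-- Incidence matrix of a lifted family at a pattern of `[n]^{d+1}` = that of the family at the truncated pattern. [this work] -/
theorem incMatrix_liftSet (A : Fin n → Finset (Pn n d)) (e : Equiv.Perm (Fin n)) (π : Fin d → Equiv.Perm (Fin n)) :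
    incMatrix (fun i => liftSet (A i)) (col ((Fin.snocEquiv fun _ : Fin (d + 1) => Equiv.Perm (Fin n)) (e, π))) =
      incMatrix A (col π) := by
  have h : ∀ c : Fin n, Fin.init (col ((Fin.snocEquiv fun _ : Fin (d + 1) => Equiv.Perm (Fin n)) (e, π)) c) = col π c := by
    intro c
    funext a
    show (Fin.snocEquiv (fun _ : Fin (d + 1) => Equiv.Perm (Fin n)) (e, π)) (Fin.castSucc a) c = π a c
    simp [Fin.snocEquiv]
  funext i c
  unfold incMatrix liftSet
  simp only [mem_filter, mem_univ, true_and, h]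

/-- **`sStarN` of lifted sets**: `sStarN n (d+1) (lift ∘ A) = n! · sStarN n d A`. [this work] -/
theorem sStarN_liftSet (A : Fin n → Finset (Pn n d)) :
    sStarN n (d + 1) (fun i => liftSet (A i)) = (Nat.factorial n : ℤ) * sStarN n d A := by
  unfold sStarN
  rw [← (Fin.snocEquiv fun _ : Fin (d + 1) => Equiv.Perm (Fin n)).sum_comp, Fintype.sum_prod_type]
  simp only [incMatrix_liftSet]
  rw [Finset.sum_const, Finset.card_univ, Fintype.card_perm, Fintype.card_fin, nsmul_eq_mul]

/-- **`PatternPosN n` is antitone in the dimension**: `PatternPosN n (d+1) → PatternPosN n d`. [this work] -/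
theorem patternPosN_anti (h : PatternPosN n (d + 1)) : PatternPosN n d := by
  intro A hA
  have h1 := h _ fun i => isUpperSet_liftSet (hA i)
  rw [sStarN_liftSet] at h1
  have hn : (0 : ℤ) < (Nat.factorial n : ℤ) := by exact_mod_cast Nat.factorial_pos n
  exact (mul_nonneg_iff_of_pos_left hn).1 h1

/-- `PatternPosN n` descends along `≤` in the dimension. [this work] -/
theorem patternPosN_of_le {d d' : ℕ} (hdd' : d ≤ d') (h : PatternPosN n d') : PatternPosN n d := by
  induction d' with
  | zero => rwa [Nat.le_zero.1 hdd']
  | succ m ih =>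
    rcases Nat.lt_or_eq_of_le hdd' with hlt | rfl
    · exact ih (Nat.lt_succ_iff.1 hlt) (patternPosN_anti h)
    · exact h

/-- The dimension-`0` case is trivial: `[n]^0` is a point and `sStarN n 0 A = K_n(constant columns)`… in fact every cell
`(0,n)` holds because a one-point lattice is Sahi-positive; we record the pattern statement for `n = 0, 1, 2` free of charge:
`PatternPosN 0 d` and `PatternPosN 1 d` hold in every dimension. [this work] -/
theorem patternPosN_zero (d : ℕ) : PatternPosN 0 d := by
  intro A _
  unfold sStarN
  exact Finset.sum_nonneg fun π _ => by simp [SahiCopyKernel.copyKernel_zero]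

/-- `PatternPosN 1 d`: `K_1 = [col π 0 ∈ A_0] ≥ 0`. [this work] -/
theorem patternPosN_one (d : ℕ) : PatternPosN 1 d := by
  intro A _
  unfold sStarN
  refine Finset.sum_nonneg fun π _ => ?_
  rw [SahiCopyKernel.copyKernel_one]
  unfold incMatrix
  split_ifs <;> simp

end

end Summit.CriticalPhenomena.PercolationContinuityZ3.Theorems.SahiGridPatternN

/-!
## Provenance note (appended 2026-08-22, doc-only)

The order-`n` pattern reduction was landed FIRST, the same day, by the lane `prim-masterthm-p3` (gen 18) in the CYCLE-form language:
`SahiSlot.patternForm`, `@[conjecture] SahiSlot.SlotPatternPos d n`, `SahiSlot.liebSahiContinuum_of_slotPatternPos`,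
`SahiSlot.sahiConjecture_of_forall_slotPatternPos`, `SahiSlot.SlotPatternPos.of_le` (files `…SahiSlotPatternBridge`, `…SahiSlotPatternPositivity`,
tree 10:32Z / 10:50Z; this file 11:51Z).  The two formalisations are ONE object: `SahiSlot.patternPosN_iff_slotPatternPos :
PatternPosN n d ↔ SlotPatternPos d n` and `SahiSlot.sStarN_cast_eq_patternForm` (`…SahiSlotPatternCopyKernel`).  In particular the column
`d ≤ 2` of the table at EVERY order is THEIR kernel theorem (`SahiSlot.slotPatternPos_two_left`, transferred as `SahiSlot.patternPosN_of_dim_le_two`):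
the censuses `PatternPosN 4 2` / `PatternPosN 5 2` quoted in the header above are confirmations of that theorem by independent engines, not its
source.  What the `SahiGridPatternN` / `SahiCopyKernel` files add: the recursion-based kernel and the `n`-copy identity for arbitrary families
(`SahiCopyKernel.sahiE_eq_sum_copyKernel`), the branching identity `sStarN_head_univ_eq` and the conditional full-slot stratum
`sStarN_nonneg_of_mem_univ` (`…OrderNStrata`, `…OrderNSymmetric`), the multilinear expansion over the pattern tensor (`…OrderNTensor`) and its
order-4 closed form (`…OrderNFour`, `…OrderNTensorFour`).
-/
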